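import Summits.QuantumFields.BalabanUV.Beta.D1BFx.GluonLocalDipSumFlat
import Summits.QuantumFields.BalabanUV.Beta.D1BFx.GluonNeedleGlue

/-!
# `BalabanUV.Beta.D1BFx.GluonLocalDipRow` — road «BF-x» for binder row D1, slot (K), END row `hGrp gN`, «GN-K» (part 4 of 4): THE `SbT ⊗ dip` PIECE OF
# THE GLUON NEEDLE ROW T₁ IS n-UNIFORM WITH ITS WEIGHT `cK = cgh·n²` INSIDE — `∃ C ≥ 0, ∀ n ≥ 1, |cK n · cellSum n a SbT (dipPiece n a) μ ν| ≤ C`, the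
# hypothesis `hd` of `GluonNeedleGlueT12.h₁_of_pieces` VERBATIM (there for `n ≥ 2`, a fortiori), modulo [B5, Prop. 1.2] ∧ [B5, (1.126)–(1.127)] BY NAME

HONEST DEPENDENCY (cell records, verbatim): «continuum YM on T⁴ ⇐ BetaPertH ∧ nine spine estimates (0/9 proved); BetaPertH ⇐ (D1) ∧ (D4) ∧
CAP+tail; G-an2-4 gates asym, D1 and NE2/3/4.»  HONEST FRAMING (cell contract, verbatim): «discharging `BetaPertH` makes Bałaban's UV stability
UNCONDITIONAL — a real constructive-QFT result; it is NOT the continuum limit and NOT the Clay problem.»  THIS MODULE DISCHARGES NOTHING of the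
wall: [folklore] counting, modulo the two NAMED printed statements `B5.Prop12Printed (fam nOf hn1 MOf a ha)` ([B5, Prop. 1.2]) and
`B5.Kernel126_127Printed (kfam nOf MOf)` ([B5, (1.126)–(1.127)]) which enter ONLY through leaf-04-g9's letter packs (`NeedleDipDipLetters.exists_legLetters`,
`GluonLegProfileD1.exists_abs_Ga_diff_left_le_profile`, `GluonLegTails.spr_Ga_of_prop12`) — hypotheses, never proved here — composed with the summed frames
`LocalVertexByPartsSum.exists_SbT_outer_tsum_bound_colGood∕rowGood` (ABSOLUTE `K`, `R`), the ends `GluonLocalDipEnds`, the four term sums `GluonLocalDipSum(Flat)`,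
leaf-04-g9's `NeedleDipShape.dipPiece_eq_outer` ∕ `locV_*`, the owner's `RankOneBubble(Jets)` (`loc_outer`, `locV_grad_of_locV`, `bubble_add∕sub_right`),
`SectorRecut.exists_biLoc_SbT`, `NeedleProjProjRow.sum_resSite_avg_le`, `WindowIdentification.fullSum_eq_tsum_sub`.  No `def`, no `def … : Prop`, nothing cited
beyond those two named statements, 0 sorry.  Root-level binders hW ∕ hR-sockets ∕ hSX-socket ∕ D1Tel ∕ D1Rep — 0 discharged; (K) NOT closed; NOT D1,
NOT `BetaPertH`, NOT continuum, NOT Clay.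

ABSOLUTE RULE (cell charter, verbatim): «No internally-minted statement may enter as a cited fact. Every hypothesis is either kernel-proved in
this package or a verbatim quotation of a PUBLISHED theorem with page reference. The manuscript(s) under audit are NOT citable for their own
disputed steps — they are the thing under adjudication; programme-internal (2001/route/tribunal) claims are never citable.»

WHY (FINDING F-d1leaf03g13-1, journal 2026-08-21 ≈12:08Z; owner records `GLUON-NEEDLE-ROWS.md` v0.2∕v0.3 «GN-CELLS» row «T₁ K-piece»; leaf-04-g9 YIELD
l.≈31300; P13: the ray pin `cK n = cgh·n²` is DISPLAYED, `cgh` n-free).  THE COUNT: the word at `(b, w)` is `−½·Σ± biBubble Ga (SbT μ (b+w)) Ga (φ⊗ψ)` over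
the four rank-one terms of the dipole; by the summed frame (by parts in `w`) each term's (1.22) sum is `≤ D_i·n⁻²` with `D_i` n-free: Coulomb-bad terms
`K·c₂·(4C₄kA₁kR n⁻²)·[(4·433·4 kL cF n⁻⁴∕ε₀)·C₀n⁴ + 3·(4·433·16 kA cF n⁻³∕ε₀²)·C₁n³]`, flat-bad terms `K·(4·433·16 kA cF n⁻⁴∕ε₀²)·[c₂·4C₄kLkR n⁻² +
3c₁·4C₄kAkR n⁻²]·C₀n⁴`; the base average is convex; `|cK n| = |cgh|·n²` eats the `n⁻²`: `C = |cgh|·(D₁+D₂+D₃+D₄)∕2`.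
* §1 [folklore] `loc_SbT`, `word_eq_four` (the word as `−½·(B₁ + B₂ − B₃ − B₄)`), `fullSum_weight_eq_tsum`.
* §2 [folklore] **`exists_locDip_row_le`**.
NOT HERE (honest): the T₂ mirror `dip ⊗ SbT` (the owner's `LocalVertexFormLeft` transposes the pointwise frame; the summed frame transposes the same way —
a later file), «GN-Q», any other cell.
Unit `b2b-balaban-beta-d1-formalise-leaf-03` (gen 13), D1 formalisation swarm, road «BF-x»; `LEAVES-BFx.md` row (N) «GN-K» (part 4, the cell).
-/

noncomputable section

namespace Summit.QuantumFields.BalabanUV.Beta.D1BFx.GluonLocalDipRow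

open Finset
open scoped BigOperators
open Literature.MathematicalPhysics.QuantumFieldTheory.Balaban1983to89
open Literature.MathematicalPhysics.QuantumFieldTheory.Balaban1983to89.Beta
open ExpKernelCalculus (Site MKer bubble)
open DyadicShell (Pt toReal toReal_apply)
open WindowIdentification (fullSum fullSum_eq_tsum_sub)
open DressedMomentNormalisation (resSite)
open VectorTailsLoc (fam kfam)
open PoissonInterior (nrm nrm_pos one_le_nrm nrm_neg supNorm supNorm_neg)
open Summit.QuantumFields.BalabanUV.Beta.TameKernelCalculus (Spr Loc bubble_add_right)
open Summit.QuantumFields.BalabanUV.Beta.D1BFx.PackedKernelSplit (biBubble bubble_eq_biBubble)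
open Summit.QuantumFields.BalabanUV.Beta.D1BFx.FineHessianSectors (biBubbleTable biBubbleTable_apply)
open Summit.QuantumFields.BalabanUV.Beta.D1BFx.RProjector (Pgt)
open Summit.QuantumFields.BalabanUV.Beta.D1BFx.GhostLeg (Ggh)
open Summit.QuantumFields.BalabanUV.Beta.D1BFx.RProjectorJet (RG)
open Summit.QuantumFields.BalabanUV.Beta.D1BFx.GluonLeg (Ga)
open Summit.QuantumFields.BalabanUV.Beta.D1BFx.GluonLegTails (spr_Ga_of_prop12)
open Summit.QuantumFields.BalabanUV.Beta.D1BFx.GluonLegProfileD1 (exists_abs_Ga_diff_left_le_profile)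
open Summit.QuantumFields.BalabanUV.Beta.D1BFx.FrozenLegTails (nOf MOf hn1)
open Summit.QuantumFields.BalabanUV.Beta.D1BFx.SectorRecut (SbT exists_biLoc_SbT)
open Summit.QuantumFields.BalabanUV.Beta.D1BFx.GluonNeedleSplit (dipPiece)
open Summit.QuantumFields.BalabanUV.Beta.D1BFx.GluonNeedleGlue (cellSum cellSum_def)
open Summit.QuantumFields.BalabanUV.Beta.D1BFx.RankOneBubble (outer applyK applyKT loc_outer bubble_sub_right LocV)
open Summit.QuantumFields.BalabanUV.Beta.D1BFx.RankOneBubbleJets (grad grad_apply locV_grad_of_locV)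
open Summit.QuantumFields.BalabanUV.Beta.D1BFx.NeedleDipShape (dipPiece_eq_outer locV_rho locV_drho locV_p locV_dp)
open Summit.QuantumFields.BalabanUV.Beta.D1BFx.NeedleDipDipLetters (exists_legLetters exists_functionLetters exp_rate_mono)
open Summit.QuantumFields.BalabanUV.Beta.D1BFx.NeedleProjProjRow (sum_resSite_avg_le)
open Summit.QuantumFields.BalabanUV.Beta.D1BFx.LocalVertexByParts (exists_SbT_outer_tsum_bound_colGood exists_SbT_outer_tsum_bound_rowGood)
open Summit.QuantumFields.BalabanUV.Beta.D1BFx.GluonLocalDipEnds (abs_applyK_grad_drho_le abs_applyK_grad_rho_le abs_applyK_grad_rho_diff_le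
  abs_applyK_flat_le abs_applyK_flat_diff_le)
open Summit.QuantumFields.BalabanUV.Beta.D1BFx.GluonLocalDipSum (tsum_term_coulBad_col_le tsum_term_coulBad_row_le tsum_term_flatBad_row_le
  tsum_term_flatBad_col_le)

/-! ## §1 The word as four rank-one bubbles; the `fullSum` reading -/

section Word

variable (n : ℕ) [NeZero n] (a : ℝ)

/-- [folklore] The transverse-completed Wilson sector is localised at every bond. -/
theorem loc_SbT (κ : Fin 4) (u : Site 4) : Loc (SbT κ u) := by
  obtain ⟨Cs, δs, hδs, hS⟩ := exists_biLoc_SbT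
  exact ⟨u, u, Cs, δs, hδs, hS κ u⟩

/-- [folklore] **THE `SbT ⊗ dip` WORD AT `(u, b)` AS FOUR RANK-ONE BUBBLES**:
`biBubbleTable Ga Ga SbT dip μ ν u b = −½·(B(∇δρ_b⊗∇p_b) + B(∇ρ_b⊗∇δp_b) − B(∇p_b⊗∇δρ_b) − B(∇δp_b⊗∇ρ_b))`, `B(φ⊗ψ) := biBubble Ga (SbT μ u) Ga (φ⊗ψ)`
(leaf-04-g9's `dipPiece_eq_outer` and the localisations of the four factors). -/
theorem word_eq_four (ha : 0 < a) (hA : Spr (Ga n a)) (μ ν : Fin 4) (u b : Site 4) :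
    biBubbleTable (Ga n a) (Ga n a) SbT (dipPiece n a) μ ν u b = -(1 / 2 : ℝ) *
      (biBubble (Ga n a) (SbT μ u) (Ga n a)
          (outer (grad (fun x => RG (Ggh n a) (Pgt n a) x (b + AffineAveraging.unitVec ν) () () - RG (Ggh n a) (Pgt n a) x b () ()))
            (grad (fun q => Pgt n a b q () ())))
        + biBubble (Ga n a) (SbT μ u) (Ga n a)
          (outer (grad (fun x => RG (Ggh n a) (Pgt n a) x b () ()))
            (grad (fun q => Pgt n a b q () () - Pgt n a (b + AffineAveraging.unitVec ν) q () ())))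
        - biBubble (Ga n a) (SbT μ u) (Ga n a)
          (outer (grad (fun q => Pgt n a b q () ()))
            (grad (fun x => RG (Ggh n a) (Pgt n a) x (b + AffineAveraging.unitVec ν) () () - RG (Ggh n a) (Pgt n a) x b () ())))
        - biBubble (Ga n a) (SbT μ u) (Ga n a)
          (outer (grad (fun q => Pgt n a b q () () - Pgt n a (b + AffineAveraging.unitVec ν) q () ()))
            (grad (fun x => RG (Ggh n a) (Pgt n a) x b () ())))) := by
  have h1 : LocV (grad (fun x => RG (Ggh n a) (Pgt n a) x (b + AffineAveraging.unitVec ν) () () - RG (Ggh n a) (Pgt n a) x b () ())) :=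
    locV_grad_of_locV (locV_drho (n := n) (a := a) (κ := ν) (u := b) ha)
  have h2 : LocV (grad (fun q => Pgt n a b q () ())) := locV_grad_of_locV (locV_p (n := n) (a := a) (u := b) ha)
  have h3 : LocV (grad (fun x => RG (Ggh n a) (Pgt n a) x b () ())) := locV_grad_of_locV (locV_rho (n := n) (a := a) (u := b) ha)
  have h4 : LocV (grad (fun q => Pgt n a b q () () - Pgt n a (b + AffineAveraging.unitVec ν) q () ())) :=
    locV_grad_of_locV (locV_dp (n := n) (a := a) (κ := ν) (u := b) ha)
  have hS : Loc (SbT μ u) := loc_SbT μ u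
  rw [biBubbleTable_apply, dipPiece_eq_outer, ← bubble_eq_biBubble, ← bubble_eq_biBubble, ← bubble_eq_biBubble, ← bubble_eq_biBubble,
    ← bubble_eq_biBubble,
    bubble_sub_right hA hS (((loc_outer h1 h2).add (loc_outer h3 h4)).sub (loc_outer h2 h1)) (loc_outer h4 h3),
    bubble_sub_right hA hS ((loc_outer h1 h2).add (loc_outer h3 h4)) (loc_outer h2 h1),
    bubble_add_right hA hS (loc_outer h1 h2) (loc_outer h3 h4)]

/-- [folklore] **THE (1.22) `fullSum` OF A SUMMABLE WEIGHTED WORD IS ITS `tsum`** (the weight vanishes at `w = 0`). -/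
theorem fullSum_weight_eq_tsum {T : Pt → ℝ} (μ ν : Fin 4) (h : Summable fun w : Pt => toReal w μ * toReal w ν * T w) :
    fullSum (fun w : Pt => toReal w μ * toReal w ν * T w) = ∑' w : Pt, toReal w μ * toReal w ν * T w := by
  rw [fullSum_eq_tsum_sub _ h]
  simp [toReal_apply]

/-- [folklore] A damped profile value is below its amplitude: `K·e^{−ε s}∕nrm(v)^p ≤ K` (`K, ε ≥ 0`). -/
theorem profile_le_const {K ε : ℝ} (hK : 0 ≤ K) (hε : 0 ≤ ε) (s : ℕ) (v : Site 4) (p : ℕ) :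
    K * Real.exp (-ε * (s : ℝ)) / nrm (d := 4) v ^ p ≤ K := by
  have h1 : Real.exp (-ε * (s : ℝ)) ≤ 1 := by
    rw [Real.exp_le_one_iff]
    exact mul_nonpos_of_nonpos_of_nonneg (neg_nonpos.mpr hε) (Nat.cast_nonneg s)
  have h2 : (1 : ℝ) ≤ nrm (d := 4) v ^ p := one_le_pow₀ (one_le_nrm (d := 4) v)
  calc K * Real.exp (-ε * (s : ℝ)) / nrm (d := 4) v ^ p ≤ K * 1 / 1 :=
        div_le_div₀ (by positivity) (mul_le_mul_of_nonneg_left h1 hK) one_pos h2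
    _ = K := by ring

/-- [folklore] The gradient of a function below a damped profile is below twice the amplitude. -/
theorem abs_grad_le_two {f : Site 4 → ℝ} {K ε : ℝ} (hK : 0 ≤ K) (hε : 0 ≤ ε) (b : Site 4) (p : ℕ)
    (hf : ∀ x : Site 4, |f x| ≤ K * Real.exp (-ε * supNorm (d := 4) (x - b)) / nrm (d := 4) (x - b) ^ p) (x : Site 4) (d' : Fin 4) :
    |grad f x d'| ≤ 2 * K := by
  rw [grad_apply]
  have h1 := (hf (x + AffineAveraging.unitVec d')).trans (profile_le_const hK hε _ _ p)
  have h2 := (hf x).trans (profile_le_const hK hε _ _ p)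
  calc |f (x + AffineAveraging.unitVec d') - f x| ≤ |f (x + AffineAveraging.unitVec d')| + |f x| := abs_sub _ _
    _ ≤ 2 * K := by linarith

/-- [folklore] The n-power bookkeeping of a Coulomb-bad term: `n⁻²·(n⁻⁴·n⁴ + n⁻³·n³) = n⁻²`. -/
theorem alg_coulBad (K c kA₁ kR C₄ kL cF ε₀ A₀ kA A₁ : ℝ) {m : ℝ} (hm : m ≠ 0) (hε : ε₀ ≠ 0) :
    K * c * (4 * kA₁ * (kR / m ^ 2) * C₄) *
        ((4 * kL * (cF / m ^ 5) * (433 * (4 * m / ε₀))) * (A₀ * m ^ 4) + 3 * (4 * kA * (cF / m ^ 5) * (433 * (4 * m / ε₀) ^ 2)) * (A₁ * m ^ 3))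
      = K * c * (4 * kA₁ * kR * C₄) * ((4 * kL * cF * (433 * (4 / ε₀))) * A₀ + 3 * (4 * kA * cF * (433 * (4 / ε₀) ^ 2)) * A₁) / m ^ 2 := by
  rw [eq_div_iff (pow_ne_zero 2 hm)]
  field_simp

/-- [folklore] The n-power bookkeeping of a flat-bad term: `n⁻⁴·n⁻²·n⁴ = n⁻²`. -/
theorem alg_flatBad (K kA cF ε₀ c₂ kL kR C₄ c₁ A₀ : ℝ) {m : ℝ} (hm : m ≠ 0) (hε : ε₀ ≠ 0) :
    K * (4 * kA * (cF / m ^ 6) * (433 * (4 * m / ε₀) ^ 2)) * (c₂ * (4 * kL * (kR / m ^ 2) * C₄) + 3 * c₁ * (4 * kA * (kR / m ^ 2) * C₄)) * (A₀ * m ^ 4)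
      = K * (4 * kA * cF * (433 * (4 / ε₀) ^ 2)) * (c₂ * (4 * kL * kR * C₄) + 3 * c₁ * (4 * kA * kR * C₄)) * A₀ / m ^ 2 := by
  rw [eq_div_iff (pow_ne_zero 2 hm)]
  field_simp

end Word

/-! ## §2 The cell: frames, ends and term sums instantiated; the n-powers cancel against `cK = cgh·n²` -/

/-- [folklore] **«GN-K»: THE `SbT ⊗ dip` PIECE OF T₁ IS n-UNIFORM WITH ITS WEIGHT INSIDE**, modulo [B5, Prop. 1.2] ∧ [B5, (1.126)–(1.127)] BY NAME and
the displayed ray pin `cK n = cgh·n²` (P13): one `C ≥ 0` with `|cK n · cellSum n a SbT (dipPiece n a) μ ν| ≤ C` for every `n ≥ 1` — hypothesis `hd` of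
`GluonNeedleGlueT12.h₁_of_pieces` (there for `n ≥ 2`, a fortiori).  `C` depends on `a`, the printed constants, the absolute frame constants and `|cgh|`. -/
theorem exists_locDip_row_le (a : ℝ) (ha : 0 < a) (h12 : B5.Prop12Printed (fam nOf hn1 MOf a ha)) (h126 : B5.Kernel126_127Printed (kfam nOf MOf))
    {cK : ℕ → ℝ} {cgh : ℝ} (hcK : ∀ n : ℕ, cK n = cgh * (n : ℝ) ^ 2) (μ ν : Fin 4) :
    ∃ C : ℝ, 0 ≤ C ∧ ∀ (n : ℕ) [NeZero n], |cK n * cellSum n a SbT (dipPiece n a) μ ν| ≤ C := by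
  -- the two summed frames (absolute constants)
  obtain ⟨Kc, Rc, hKc, hcol⟩ := exists_SbT_outer_tsum_bound_colGood
  obtain ⟨Kr, Rr, hKr, hrow⟩ := exists_SbT_outer_tsum_bound_rowGood
  -- the letters
  obtain ⟨ε₁, kA, kA₁, hε₁, hε₁1, hkA, hkA₁, hleg⟩ := exists_legLetters a ha h12 h126
  obtain ⟨ε₂, cF, kR, hε₂, hε₂1, hcF, hkR, hfun⟩ := exists_functionLetters a ha
  obtain ⟨kL, δL, hδL, hkL, hleft⟩ := exists_abs_Ga_diff_left_le_profile a ha h12 h126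
  -- the common rate
  set ε₀ : ℝ := min ε₁ (min ε₂ δL) with hε₀
  have hε₀0 : 0 < ε₀ := lt_min hε₁ (lt_min hε₂ hδL)
  have hε₀1 : ε₀ ≤ 1 := (min_le_left _ _).trans hε₁1
  have hε₀ε₁ : ε₀ ≤ ε₁ := min_le_left _ _
  have hε₀ε₂ : ε₀ ≤ ε₂ := (min_le_right _ _).trans (min_le_left _ _)
  have hε₀δL : ε₀ ≤ δL := (min_le_right _ _).trans (min_le_right _ _)
  -- the n-free constants
  set C₄ : ℝ := 4 * 2 ^ (4 + 3) * 9 ^ (4 - 1) with hC₄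
  set A₀ : ℝ := 1 + 1296 * ((2 / ε₀) ^ 3 * (1 + 2 / ε₀)) with hA₀
  set A₁ : ℝ := 1 + 432 * ((2 / ε₀) ^ 2 * (1 + 2 / ε₀)) with hA₁
  set cr₂ : ℝ := Real.exp (ε₀ * Rr) * ((Rr : ℝ) + 1) ^ 2 with hcr₂
  set cr₁ : ℝ := Real.exp (ε₀ * Rr) * ((Rr : ℝ) + 1) ^ 1 with hcr₁
  set cc₂ : ℝ := Real.exp (ε₀ * Rc) * ((Rc : ℝ) + 1) ^ 2 with hcc₂
  set cc₁ : ℝ := Real.exp (ε₀ * Rc) * ((Rc : ℝ) + 1) ^ 1 with hcc₁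
  -- D₁ (term `∇δρ⊗∇p`, rowGood), D₃ (term `∇p⊗∇δρ`, colGood): `K·c₂·(4C₄kA₁kR)·[(4kL cF·433·4∕ε₀)·A₀ + 3·(4kA cF·433·16∕ε₀²)·A₁]`
  set D₁ : ℝ := Kr * cr₂ * (4 * kA₁ * kR * C₄) * ((4 * kL * cF * (433 * (4 / ε₀))) * A₀ + 3 * (4 * kA * cF * (433 * (4 / ε₀) ^ 2)) * A₁) with hD₁
  set D₃ : ℝ := Kc * cc₂ * (4 * kA₁ * kR * C₄) * ((4 * kL * cF * (433 * (4 / ε₀))) * A₀ + 3 * (4 * kA * cF * (433 * (4 / ε₀) ^ 2)) * A₁) with hD₃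
  -- D₂ (term `∇ρ⊗∇δp`, colGood), D₄ (term `∇δp⊗∇ρ`, rowGood): `K·(4kA cF·433·16∕ε₀²)·(c₂·4C₄kLkR + 3c₁·4C₄kAkR)·A₀`
  set D₂ : ℝ := Kc * (4 * kA * cF * (433 * (4 / ε₀) ^ 2)) * (cc₂ * (4 * kL * kR * C₄) + 3 * cc₁ * (4 * kA * kR * C₄)) * A₀ with hD₂
  set D₄ : ℝ := Kr * (4 * kA * cF * (433 * (4 / ε₀) ^ 2)) * (cr₂ * (4 * kL * kR * C₄) + 3 * cr₁ * (4 * kA * kR * C₄)) * A₀ with hD₄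
  have hD : 0 ≤ (D₁ + D₂ + D₃ + D₄) / 2 := by positivity
  refine ⟨|cgh| * ((D₁ + D₂ + D₃ + D₄) / 2), mul_nonneg (abs_nonneg _) hD, fun n _ => ?_⟩
  have hn : (0 : ℝ) < n := by exact_mod_cast Nat.pos_of_ne_zero (NeZero.ne n)
  have hA : Spr (Ga n a) := spr_Ga_of_prop12 (a := a) (ha := ha) h12 h126 n
  -- letters at this n
  obtain ⟨hA0, hA0', hA1, -⟩ := hleg ε₀ hε₀0 hε₀ε₁ n
  have hAL : ∀ (x y : Site 4) (c d i : Fin 4), |Ga n a (x + AffineAveraging.unitVec i) y c d - Ga n a x y c d|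
      ≤ kL * Real.exp (-(ε₀ / n) * supNorm (x - y)) / nrm (x - y) ^ 3 := fun x y c d i =>
    (hleft n x y c d i).trans (div_le_div_of_nonneg_right (mul_le_mul_of_nonneg_left (exp_rate_mono n hε₀δL _) hkL)
      (pow_pos (nrm_pos _) 3).le)
  have hn0 : (n : ℝ) ≠ 0 := hn.ne'
  have hε₀ne : ε₀ ≠ 0 := hε₀0.ne'
  have hεn : 0 ≤ ε₀ / n := by positivity
  -- ONE BASE SITE
  have hsite : ∀ b : Pt, |fullSum (fun w : Pt => toReal w μ * toReal w ν * biBubbleTable (Ga n a) (Ga n a) SbT (dipPiece n a) μ ν (b + w) b)|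
      ≤ (D₁ + D₂ + D₃ + D₄) / 2 / (n : ℝ) ^ 2 := by
    intro b
    obtain ⟨hp, hdp, hρ, hδρ⟩ := hfun ε₀ hε₀0 hε₀ε₂ n b ν
    -- the four functions and their crude bounds
    set fδρ : Site 4 → ℝ := fun x => RG (Ggh n a) (Pgt n a) x (b + AffineAveraging.unitVec ν) () () - RG (Ggh n a) (Pgt n a) x b () () with hfδρ
    set fρ : Site 4 → ℝ := fun x => RG (Ggh n a) (Pgt n a) x b () () with hfρ
    set fp : Site 4 → ℝ := fun q => Pgt n a b q () () with hfp
    set fδp : Site 4 → ℝ := fun q => Pgt n a b q () () - Pgt n a (b + AffineAveraging.unitVec ν) q () () with hfδp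
    have hcF5 : 0 ≤ cF / (n : ℝ) ^ 5 := by positivity
    have hcF6 : 0 ≤ cF / (n : ℝ) ^ 6 := by positivity
    have hkRn : 0 ≤ kR / (n : ℝ) ^ 2 := by positivity
    have hbp : ∀ (y : Site 4) (d : Fin 4), |grad fp y d| ≤ cF / (n : ℝ) ^ 5 := fun y d =>
      (hp y d).trans (by simpa using profile_le_const hcF5 hεn (supNorm (d := 4) (y - b)) (y - b) 0)
    have hbdp : ∀ (y : Site 4) (d : Fin 4), |grad fδp y d| ≤ cF / (n : ℝ) ^ 6 := fun y d =>
      (hdp y d).trans (by simpa using profile_le_const hcF6 hεn (supNorm (d := 4) (y - b)) (y - b) 0)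
    have hbρ : ∀ (x : Site 4) (d : Fin 4), |grad fρ x d| ≤ kR / (n : ℝ) ^ 2 := fun x d =>
      (hρ x d).trans (profile_le_const hkRn hεn _ (x - b) 3)
    have hbδρ : ∀ (x : Site 4) (d : Fin 4), |grad fδρ x d| ≤ 2 * (kR / (n : ℝ) ^ 2) := fun x d =>
      abs_grad_le_two hkRn hεn b 3 hδρ x d
    -- the ends
    have hGδρ := fun q c => abs_applyK_grad_drho_le n b hε₀0 hkA (by positivity : (0:ℝ) ≤ 4 * Real.exp 1 * kA) hkA₁ hkR hA0 hA0' hA1 hδρ q c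
    have hGρ := fun q c => abs_applyK_grad_rho_le n b hε₀0 hkA hkR hA0 hρ q c
    have hGρ' := fun q c i => abs_applyK_grad_rho_diff_le n b hA hε₀0 hkL hkR hAL hρ q c i
    have hGp := fun q c => abs_applyK_flat_le n b hε₀0 hε₀1 hkA hcF5 hA0 hp q c
    have hGp' := fun q c i => abs_applyK_flat_diff_le n b hA hε₀0 hε₀1 hkL hcF5 hAL hp q c i
    have hGδp := fun q c => abs_applyK_flat_le n b hε₀0 hε₀1 hkA hcF6 hA0 hdp q c
    -- the four term sums, each `≤ D_i ∕ n²`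
    obtain ⟨hs₁, hb₁⟩ := tsum_term_coulBad_col_le n a ha hKr hrow hA hε₀0 (by positivity) (by positivity) (by positivity) b hbp hGδρ hGp hGp' μ ν
    obtain ⟨hs₂, hb₂⟩ := tsum_term_flatBad_row_le n a ha hKc hcol hA hε₀0 (by positivity) (by positivity) (by positivity) b hbdp hGδp hGρ hGρ' μ ν
    obtain ⟨hs₃, hb₃⟩ := tsum_term_coulBad_row_le n a ha hKc hcol hA hε₀0 (by positivity) (by positivity) (by positivity) b hbδρ hGδρ hGp hGp' μ ν
    obtain ⟨hs₄, hb₄⟩ := tsum_term_flatBad_col_le n a ha hKr hrow hA hε₀0 (by positivity) (by positivity) (by positivity) b hbρ hGδp hGρ hGρ' μ ν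
    replace hb₁ := hb₁.trans (le_of_eq (alg_coulBad _ _ _ _ _ _ _ _ _ _ _ hn0 hε₀ne))
    replace hb₃ := hb₃.trans (le_of_eq (alg_coulBad _ _ _ _ _ _ _ _ _ _ _ hn0 hε₀ne))
    replace hb₂ := hb₂.trans (le_of_eq (alg_flatBad _ _ _ _ _ _ _ _ _ _ hn0 hε₀ne))
    replace hb₄ := hb₄.trans (le_of_eq (alg_flatBad _ _ _ _ _ _ _ _ _ _ hn0 hε₀ne))
    -- the word's sum
    set W : Pt → ℝ := fun w => toReal w μ * toReal w ν with hW
    set B₁ : Pt → ℝ := fun w => biBubble (Ga n a) (SbT μ (b + w)) (Ga n a) (outer (grad fδρ) (grad fp)) with hB₁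
    set B₂ : Pt → ℝ := fun w => biBubble (Ga n a) (SbT μ (b + w)) (Ga n a) (outer (grad fρ) (grad fδp)) with hB₂
    set B₃ : Pt → ℝ := fun w => biBubble (Ga n a) (SbT μ (b + w)) (Ga n a) (outer (grad fp) (grad fδρ)) with hB₃
    set B₄ : Pt → ℝ := fun w => biBubble (Ga n a) (SbT μ (b + w)) (Ga n a) (outer (grad fδp) (grad fρ)) with hB₄
    have e : ∀ w : Pt, toReal w μ * toReal w ν * biBubbleTable (Ga n a) (Ga n a) SbT (dipPiece n a) μ ν (b + w) b
        = -(1 / 2 : ℝ) * (W w * B₁ w + W w * B₂ w - W w * B₃ w - W w * B₄ w) := fun w => by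
      rw [word_eq_four n a ha hA μ ν (b + w) b]; simp only [hW, hB₁, hB₂, hB₃, hB₄]; ring
    have hsum : Summable fun w : Pt => W w * B₁ w + W w * B₂ w - W w * B₃ w - W w * B₄ w := ((hs₁.add hs₂).sub hs₃).sub hs₄
    have hsumW : Summable fun w : Pt => toReal w μ * toReal w ν * biBubbleTable (Ga n a) (Ga n a) SbT (dipPiece n a) μ ν (b + w) b := by
      simp_rw [e]; exact hsum.mul_left _
    rw [fullSum_weight_eq_tsum μ ν hsumW]
    simp_rw [e]
    rw [tsum_mul_left, ((hs₁.add hs₂).sub hs₃).tsum_sub hs₄, (hs₁.add hs₂).tsum_sub hs₃, hs₁.tsum_add hs₂, abs_mul,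
      show |(-(1 / 2 : ℝ))| = 1 / 2 by norm_num]
    have htri : |∑' w, W w * B₁ w + ∑' w, W w * B₂ w - ∑' w, W w * B₃ w - ∑' w, W w * B₄ w|
        ≤ |∑' w, W w * B₁ w| + |∑' w, W w * B₂ w| + |∑' w, W w * B₃ w| + |∑' w, W w * B₄ w| := by
      refine (abs_sub _ _).trans (add_le_add ((abs_sub _ _).trans (add_le_add (abs_add_le _ _) le_rfl)) le_rfl)
    calc (1 / 2 : ℝ) * |∑' w, W w * B₁ w + ∑' w, W w * B₂ w - ∑' w, W w * B₃ w - ∑' w, W w * B₄ w|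
        ≤ (1 / 2 : ℝ) * (D₁ / (n : ℝ) ^ 2 + D₂ / (n : ℝ) ^ 2 + D₃ / (n : ℝ) ^ 2 + D₄ / (n : ℝ) ^ 2) :=
          mul_le_mul_of_nonneg_left (htri.trans (add_le_add (add_le_add (add_le_add hb₁ hb₂) hb₃) hb₄)) (by norm_num)
      _ = (D₁ + D₂ + D₃ + D₄) / 2 / (n : ℝ) ^ 2 := by ring
  -- THE BASE AVERAGE AND THE WEIGHT
  rw [cellSum_def, abs_mul, hcK n, abs_mul, abs_of_nonneg (by positivity : (0 : ℝ) ≤ (n : ℝ) ^ 2)]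
  calc |cgh| * (n : ℝ) ^ 2 * |∑ b ∈ (univ : Finset (Fin 4 → Fin n)).image resSite, ((n : ℝ) ^ 4)⁻¹ *
          fullSum (fun w : Pt => toReal w μ * toReal w ν * biBubbleTable (Ga n a) (Ga n a) SbT (dipPiece n a) μ ν (b + w) b)|
      ≤ |cgh| * (n : ℝ) ^ 2 * ∑ b ∈ (univ : Finset (Fin 4 → Fin n)).image resSite, ((n : ℝ) ^ 4)⁻¹ * ((D₁ + D₂ + D₃ + D₄) / 2 / (n : ℝ) ^ 2) := by
        refine mul_le_mul_of_nonneg_left ((Finset.abs_sum_le_sum_abs _ _).trans (Finset.sum_le_sum fun b _ => ?_))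
          (mul_nonneg (abs_nonneg _) (pow_nonneg hn.le 2))
        rw [abs_mul, abs_of_nonneg (by positivity : (0 : ℝ) ≤ ((n : ℝ) ^ 4)⁻¹)]
        exact mul_le_mul_of_nonneg_left (hsite b) (by positivity)
    _ ≤ |cgh| * (n : ℝ) ^ 2 * ((D₁ + D₂ + D₃ + D₄) / 2 / (n : ℝ) ^ 2) :=
        mul_le_mul_of_nonneg_left (sum_resSite_avg_le (div_nonneg hD (pow_nonneg hn.le 2))) (mul_nonneg (abs_nonneg _) (pow_nonneg hn.le 2))
    _ = |cgh| * ((D₁ + D₂ + D₃ + D₄) / 2) := by field_simp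

end Summit.QuantumFields.BalabanUV.Beta.D1BFx.GluonLocalDipRow

end
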